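import Summits.ABC.ABC.Theses.IsogenyGlueCongruence
import Summits.ABC.ABC.Theorems.SharpDegreeOfPolyHeight.Negative.HypothesisFloor

/-!
# `PolyHeightOfBoundedPrimes` (stmt-ABC-16006, crux B' of route IsogenyGlueCongruence) —
the hypothesis A is void in the abstract, even calibrated; binder and height-form bookkeeping

Negative support (cdisprove seat `refuter-cdisprove-stmt-ABC-16006-0`, cycle 1, 2026-08-16).
B' is `A → H` with `A = DegreePrimesPolyBounded` (the prime factors of the modular degree of a
semistable globally minimal elliptic `W/ℚ` are `≤ C·N^κ`) and `H` the polynomial height conjecture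
for semistable curves (`max(|Δ_W|, |c₄(W)|³) ≤ C·N_W^σ`). Kernel-checked statements about HOW the
hypothesis can and cannot enter, and two reformulations of the consequent:

* `abstractPolyHeightOfBoundedPrimes_iff` — replace "the modular degree of some datum of `W`" in A
  by an ARBITRARY positive-integer invariant `d(W)`: the resulting (stronger) item is exactly `H`
  (witness `d ≡ 1`). Contrast crux B, whose abstract form is FALSE
  (`PolyDegreeOfBoundedPrimes.Negative.not_abstractPolyOfBoundedPrimes`, `2ⁿ`): B' never mentions
  the SIZE of `deg φ`, so A is logically inert unless tied to the height.
* `calibratedAbstractPolyHeightOfBoundedPrimes_iff` — tie it: demand that `d(W)` dominate ANY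
  prescribed function `g` of the height quantity `max(|Δ_W|, |c₄(W)|³)` (the landed Zagier–Silverman
  calibration `deg φ/c² ≫ max^{1/6}` is of this kind). The item is STILL exactly `H` (witness
  `d = 2^{g(·)}`: one prime factor `2 ≤ 2·N⁰`, unbounded 2-adic depth). Hence no proof of B' can run
  "deg φ/c² is large and has only small prime factors, therefore …": the quantity to be bounded is
  the total contact `Σ_ℓ v_ℓ(deg φ/c²)·log ℓ` against `log N` (depth × multiplicity of the congruence
  primes), through arithmetic special to modular degrees.
* `polyHeight_iff_noNeZero` — the binder `[NeZero (W.conductorNorm ℤ)]` of `H` is decoration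
  (`conductorNorm_pos_holds`); it only types A.
* `polyHeight_iff_naive`, `not_naiveHeightAt_of_le_six` — `H` is equivalent to its naive-height form
  `max(|c₄|³, c₆²) ≤ C·N^σ` (`1728Δ = c₄³ − c₆²`), and that form has the same floor `σ > 6`
  (Masser 1990 through the landed `SharpDegreeOfPolyHeight.Negative.not_polyHeightAt_of_le_six`).

No Theses statement is asserted; every `↔ H` here has the OPEN conjecture `H` on both sides.
-/

noncomputable section

-- `Summit.<Summit>.<Problem>`: for the single-conjunct summit `ABC` the duplicate `ABC.ABC` is mandated.
set_option linter.dupNamespace false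

open Summit.ABC.ABC.Theses.IsogenyGlueCongruence
open WeierstrassCurve

namespace Summit.ABC.ABC.Theorems.PolyHeightOfBoundedPrimes.Negative

/-! ## The hypothesis in the abstract -/

/-- **The abstract form of B' is exactly `H`.** For EVERY positive-integer invariant `d` of
Weierstrass curves whose prime factors are polynomially bounded in the conductor (A with `deg φ`
replaced by `d`), `H` — iff `H` (witness `d ≡ 1`, which has no prime factor). [folklore] -/
theorem abstractPolyHeightOfBoundedPrimes_iff :
    (∀ d : WeierstrassCurve ℚ → ℕ, (∀ W, 0 < d W) →
      (∃ κ C : ℝ, ∀ (W : WeierstrassCurve ℚ) [W.IsElliptic] [W.IsGloballyMinimal]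
        [NeZero (W.conductorNorm ℤ)], W.IsSemistable ℤ →
          ∀ ℓ : ℕ, ℓ.Prime → ℓ ∣ d W → (ℓ : ℝ) ≤ C * (W.conductorNorm ℤ : ℝ) ^ κ) →
      ∃ σ C : ℝ, ∀ (W : WeierstrassCurve ℚ) [W.IsElliptic] [W.IsGloballyMinimal]
        [NeZero (W.conductorNorm ℤ)], W.IsSemistable ℤ →
          ((max |W.Δ| (|W.c₄| ^ 3) : ℚ) : ℝ) ≤ C * (W.conductorNorm ℤ : ℝ) ^ σ) ↔
    ∃ σ C : ℝ, ∀ (W : WeierstrassCurve ℚ) [W.IsElliptic] [W.IsGloballyMinimal]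
      [NeZero (W.conductorNorm ℤ)], W.IsSemistable ℤ →
        ((max |W.Δ| (|W.c₄| ^ 3) : ℚ) : ℝ) ≤ C * (W.conductorNorm ℤ : ℝ) ^ σ := by
  refine ⟨fun h ↦ h (fun _ ↦ 1) (fun _ ↦ one_pos) ⟨0, 0, fun _ _ _ _ _ _ hℓ hdvd ↦ ?_⟩,
    fun hH _ _ _ ↦ hH⟩
  exact absurd (Nat.le_of_dvd one_pos hdvd) (not_le.mpr hℓ.one_lt)

/-- Powers of two have the single prime factor `2 ≤ 2·N⁰`: the abstract hypothesis holds for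
`d = 2^{e(·)}` whatever the exponents. [folklore] -/
theorem abstractHyp_two_pow (e : WeierstrassCurve ℚ → ℕ) :
    ∃ κ C : ℝ, ∀ (W : WeierstrassCurve ℚ) [W.IsElliptic] [W.IsGloballyMinimal]
      [NeZero (W.conductorNorm ℤ)], W.IsSemistable ℤ →
        ∀ ℓ : ℕ, ℓ.Prime → ℓ ∣ 2 ^ e W → (ℓ : ℝ) ≤ C * (W.conductorNorm ℤ : ℝ) ^ κ := by
  refine ⟨0, 2, fun W _ _ _ _ ℓ hℓ hdvd ↦ ?_⟩
  have h2 : ℓ = 2 := (Nat.prime_dvd_prime_iff_eq hℓ Nat.prime_two).mp (hℓ.dvd_of_dvd_pow hdvd)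
  subst h2
  simp

/-- **Even calibrated, the abstract form of B' is exactly `H`.** Requiring in addition that the
invariant `d(W)` dominate a prescribed function `g` of `max(|Δ_W|, |c₄(W)|³)` (any growth), the
abstract item is still `↔ H`: witness `d(W) = 2^{g(max(|Δ_W|,|c₄(W)|³))}` (dominates `g`, one prime
factor, unbounded depth). So prime SIZES of a height-calibrated integer carry no information; a
proof of B' must bound DEPTH × MULTIPLICITY of the congruence primes of `f_E`. [folklore] -/
theorem calibratedAbstractPolyHeightOfBoundedPrimes_iff (g : ℚ → ℕ) :
    (∀ d : WeierstrassCurve ℚ → ℕ,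
      (∀ W : WeierstrassCurve ℚ, g (max |W.Δ| (|W.c₄| ^ 3)) ≤ d W) → (∀ W, 0 < d W) →
      (∃ κ C : ℝ, ∀ (W : WeierstrassCurve ℚ) [W.IsElliptic] [W.IsGloballyMinimal]
        [NeZero (W.conductorNorm ℤ)], W.IsSemistable ℤ →
          ∀ ℓ : ℕ, ℓ.Prime → ℓ ∣ d W → (ℓ : ℝ) ≤ C * (W.conductorNorm ℤ : ℝ) ^ κ) →
      ∃ σ C : ℝ, ∀ (W : WeierstrassCurve ℚ) [W.IsElliptic] [W.IsGloballyMinimal]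
        [NeZero (W.conductorNorm ℤ)], W.IsSemistable ℤ →
          ((max |W.Δ| (|W.c₄| ^ 3) : ℚ) : ℝ) ≤ C * (W.conductorNorm ℤ : ℝ) ^ σ) ↔
    ∃ σ C : ℝ, ∀ (W : WeierstrassCurve ℚ) [W.IsElliptic] [W.IsGloballyMinimal]
      [NeZero (W.conductorNorm ℤ)], W.IsSemistable ℤ →
        ((max |W.Δ| (|W.c₄| ^ 3) : ℚ) : ℝ) ≤ C * (W.conductorNorm ℤ : ℝ) ^ σ := by
  refine ⟨fun h ↦ h (fun W ↦ 2 ^ g (max |W.Δ| (|W.c₄| ^ 3))) (fun W ↦ ?_)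
    (fun W ↦ Nat.two_pow_pos _) (abstractHyp_two_pow _), fun hH _ _ _ _ ↦ hH⟩
  exact (Nat.lt_two_pow_self).le

/-! ## Binder bookkeeping: `[NeZero (W.conductorNorm ℤ)]` is decoration -/

/-- **`H` does not need the binder `[NeZero (W.conductorNorm ℤ)]`**: `N_W ≥ 1` for every elliptic
`W/ℚ` (`conductorNorm_pos_holds`), so the consequent of B' is equivalent to the form without it (the
binder only types the datum `ModularParametrizationData W N_W` in A). [folklore] -/
theorem polyHeight_iff_noNeZero :
    (∃ σ C : ℝ, ∀ (W : WeierstrassCurve ℚ) [W.IsElliptic] [W.IsGloballyMinimal]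
      [NeZero (W.conductorNorm ℤ)], W.IsSemistable ℤ →
        ((max |W.Δ| (|W.c₄| ^ 3) : ℚ) : ℝ) ≤ C * (W.conductorNorm ℤ : ℝ) ^ σ) ↔
    ∃ σ C : ℝ, ∀ (W : WeierstrassCurve ℚ) [W.IsElliptic] [W.IsGloballyMinimal],
      W.IsSemistable ℤ → ((max |W.Δ| (|W.c₄| ^ 3) : ℚ) : ℝ) ≤ C * (W.conductorNorm ℤ : ℝ) ^ σ := by
  constructor
  · rintro ⟨σ, C, h⟩
    refine ⟨σ, C, fun W _ _ hW ↦ ?_⟩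
    haveI : NeZero (W.conductorNorm ℤ) := ⟨(W.conductorNorm_pos_holds).ne'⟩
    exact h W hW
  · rintro ⟨σ, C, h⟩
    exact ⟨σ, C, fun W _ _ _ hW ↦ h W hW⟩

/-! ## The naive-height form of the consequent -/

/-- `max(|Δ|, |c₄|³) ≤ max(|c₄|³, c₆²)` for every Weierstrass curve: `1728Δ = c₄³ − c₆²` (Mathlib
`c_relation`) gives `1728|Δ| ≤ |c₄|³ + c₆² ≤ 2·max`. [folklore] -/
theorem max_Δ_c4_le_naive (W : WeierstrassCurve ℚ) :
    max |W.Δ| (|W.c₄| ^ 3) ≤ max (|W.c₄| ^ 3) (W.c₆ ^ 2) := by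
  have hrel : (1728 : ℚ) * W.Δ = W.c₄ ^ 3 - W.c₆ ^ 2 := W.c_relation
  have h3 : |W.c₄| ^ 3 = |W.c₄ ^ 3| := (abs_pow W.c₄ 3).symm
  refine max_le ?_ (le_max_left _ _)
  have hc6 : (0 : ℚ) ≤ W.c₆ ^ 2 := sq_nonneg _
  have hA : |W.c₄ ^ 3| ≤ max (|W.c₄| ^ 3) (W.c₆ ^ 2) := h3 ▸ le_max_left _ _
  have hB : W.c₆ ^ 2 ≤ max (|W.c₄| ^ 3) (W.c₆ ^ 2) := le_max_right _ _
  have habs : (1728 : ℚ) * |W.Δ| ≤ |W.c₄ ^ 3| + W.c₆ ^ 2 := by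
    rw [← abs_of_pos (by norm_num : (0 : ℚ) < 1728), ← abs_mul, hrel]
    calc |W.c₄ ^ 3 - W.c₆ ^ 2| ≤ |W.c₄ ^ 3| + |W.c₆ ^ 2| := abs_sub _ _
      _ = |W.c₄ ^ 3| + W.c₆ ^ 2 := by rw [abs_of_nonneg hc6]
  nlinarith [abs_nonneg W.Δ]

/-- `max(|c₄|³, c₆²) ≤ 1729·max(|Δ|, |c₄|³)` for every Weierstrass curve (`c₆² = c₄³ − 1728Δ`).
[folklore] -/
theorem naive_le_max_Δ_c4 (W : WeierstrassCurve ℚ) :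
    max (|W.c₄| ^ 3) (W.c₆ ^ 2) ≤ 1729 * max |W.Δ| (|W.c₄| ^ 3) := by
  have hrel : (1728 : ℚ) * W.Δ = W.c₄ ^ 3 - W.c₆ ^ 2 := W.c_relation
  have h3 : |W.c₄| ^ 3 = |W.c₄ ^ 3| := (abs_pow W.c₄ 3).symm
  have hM0 : (0 : ℚ) ≤ max |W.Δ| (|W.c₄| ^ 3) := le_trans (abs_nonneg _) (le_max_left _ _)
  have hA : |W.c₄ ^ 3| ≤ max |W.Δ| (|W.c₄| ^ 3) := by rw [← h3]; exact le_max_right _ _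
  have hD : |W.Δ| ≤ max |W.Δ| (|W.c₄| ^ 3) := le_max_left _ _
  refine max_le ?_ ?_
  · exact le_trans (le_max_right _ _) (le_mul_of_one_le_left hM0 (by norm_num))
  · have h6 : W.c₆ ^ 2 = W.c₄ ^ 3 - 1728 * W.Δ := by linarith
    rw [h6]
    linarith [le_abs_self (W.c₄ ^ 3), neg_le_abs W.Δ]

/-- **`H` is equivalent to its naive-height form** `max(|c₄|³, c₆²) ≤ C·N^σ` (Pasten's
`h(E) = (1/12) log max(|c₄³|, |c₆²|)` on a minimal model; constants `C ↦ 1729·C` and back `C ↦ C`).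
[cite: PastenShimura2024, §3] -/
theorem polyHeight_iff_naive :
    (∃ σ C : ℝ, ∀ (W : WeierstrassCurve ℚ) [W.IsElliptic] [W.IsGloballyMinimal]
      [NeZero (W.conductorNorm ℤ)], W.IsSemistable ℤ →
        ((max |W.Δ| (|W.c₄| ^ 3) : ℚ) : ℝ) ≤ C * (W.conductorNorm ℤ : ℝ) ^ σ) ↔
    ∃ σ C : ℝ, ∀ (W : WeierstrassCurve ℚ) [W.IsElliptic] [W.IsGloballyMinimal]
      [NeZero (W.conductorNorm ℤ)], W.IsSemistable ℤ →
        ((max (|W.c₄| ^ 3) (W.c₆ ^ 2) : ℚ) : ℝ) ≤ C * (W.conductorNorm ℤ : ℝ) ^ σ := by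
  constructor
  · rintro ⟨σ, C, h⟩
    refine ⟨σ, 1729 * C, fun W _ _ _ hW ↦ ?_⟩
    have h1 := h W hW
    have h2 : ((max (|W.c₄| ^ 3) (W.c₆ ^ 2) : ℚ) : ℝ) ≤ ((1729 * max |W.Δ| (|W.c₄| ^ 3) : ℚ) : ℝ) :=
      Rat.cast_le.mpr (naive_le_max_Δ_c4 W)
    have h3 := mul_le_mul_of_nonneg_left h1 (by norm_num : (0 : ℝ) ≤ 1729)
    push_cast at h2 h3 ⊢
    linarith
  · rintro ⟨σ, C, h⟩
    refine ⟨σ, C, fun W _ _ _ hW ↦ le_trans ?_ (h W hW)⟩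
    exact_mod_cast max_Δ_c4_le_naive W

/-- **The naive-height form has the same floor: no `σ ≤ 6` slice holds, for any constant** (Masser's
semistable curves through the landed `not_polyHeightAt_of_le_six` and `max_Δ_c4_le_naive`). So in
Pasten's normalisation `h = (1/12) log max(|c₄³|,|c₆²|)` the consequent of B' also lives strictly
above Szpiro's exponent. [cite: Masser1990, Theorem and Lemma 1] -/
theorem not_naiveHeightAt_of_le_six {σ : ℝ} (hσ : σ ≤ 6) :
    ¬ ∃ C : ℝ, ∀ (W : WeierstrassCurve ℚ) [W.IsElliptic] [W.IsGloballyMinimal]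
      [NeZero (W.conductorNorm ℤ)], W.IsSemistable ℤ →
        ((max (|W.c₄| ^ 3) (W.c₆ ^ 2) : ℚ) : ℝ) ≤ C * (W.conductorNorm ℤ : ℝ) ^ σ := by
  rintro ⟨C, h⟩
  refine Summit.ABC.ABC.Theorems.SharpDegreeOfPolyHeight.Negative.not_polyHeightAt_of_le_six hσ
    ⟨C, fun W _ _ _ hW ↦ le_trans ?_ (h W hW)⟩
  exact_mod_cast max_Δ_c4_le_naive W

end Summit.ABC.ABC.Theorems.PolyHeightOfBoundedPrimes.Negative

end
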